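import Mathlib
import HarnessLib
import Summits.NavierStokesRegularity.NavierStokesRegularity.Theorems.TaylorModelRungThreeVDefs

/-!
# Line `taylor-model` on crux K1b-DR (stmt-NavierStokesRegularity-23954) — v3 (VECTOR STEP) semantic interface, part 2:
# `RadiiData`, `NodePair`, `DerivEncl`, `ChainVRadii`, `ChainV`   [successor engine-1 g67 = FormatV / ChainVRadii pen;
# director rulings dss_56/58/63/65, ownership split tm-g4 g3 08:58Z / 09:28Z, PROPAGATE-V-SPEC-cert1 rev. bcee1edc560e3a8a §1–§2]

Definitions-only module (no theorems, no sorry), companion of `…TaylorModelRungThreeVDefs` (tm-g4 g3: `StepBoxes`,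
`NodeStart`, `ChainVCore`, `IsFlowPackageV`). It hosts the CROSS-STEP half of the frame-absorbed vector step in the SPLIT
architecture of the only validated run (ewr3, re-derived by cert-1 g2's float twin on stages 34 and 1):

* the dominant LINEAR part of every transported object is an exact point-matrix product — per node a POINT transport map
  `Vc` (`Vc_{s+1}` = the checker's rounding of `mid[M_s]·Vc_s`, never inverted, never taken in absolute value), which
  carries the polytope image with CONSTANT box radii `rB` (stage datum, `q = x j 0 + Dsc j ζ`, `|ζ| ≤ rB`);
* only second-order-small errors live in boxes / one re-orthonormalised frame: the centre-trajectory radii `bx.rPl 0`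
  in the frame `cd.Cm` (inverse `cd.Ci`, Neumann-certified by `…CertificateFrameNeumann`), a PLAIN per-coordinate set
  error `e`, and the derivative-error kernel interval `[Zlo, Zhi]` in the frame `cd.Cm`;
* NO scalar level and NO level-2 set is propagated (PROPAGATE-V-SPEC §0 F3; the κ-tube is the constant inflation of
  `ChainVCore`'s (D1κ)/(J) boxes, read by the Λ products of `ReadoutsV`).

Objects: a window KERNEL `Ker := Fin 4 → ℤ → Fin 4 → ℤ → ℝ` (the shape of `bx.Mlo/Mhi` and of the mean-value matrix
of (F8′)), its action `kapp` through the semantic window enumeration (VERBATIM the right-hand side of (F8′)), interval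
membership `KerMem`; the record `RadiiData`; the level-1 node PAIR `NodePair` (centre point `y₀ ∈ X⁰_s = NodeStart … 0`,
parameter `ζ`, `y − y₀ − Vc ζ` in the plain box — the affine parametrisation the C¹ landing read-out needs); the
derivative enclosure `DerivEncl` (`L ∈ Vc + Cm·[Z]`); and `ChainVRadii cd bx rd` = per stage: `Dsc`/`Vc` linear and
window-supported, `rB, e ≥ 0`, ENTRY (polytope ⊆ `x 0 + Dsc·[±rB]`, `Vc 0 = Dsc`, `0 ∈ [Z 0]`), the HINGE «level-1
pairs lie in the hull `[hlo 1, hhi 1]`» (the one clause `IsFlowPackageV`'s hull-based package needs from this side,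
tm-g4 09:28Z), and per sub-step the fresh centre-error bound `ν` and the three cross-step relations quantified over
EVERY real kernel `A ∈ [Mlo, Mhi]` — centre radii absorption through `Ci`, plain set-error update, derivative-error
transport — so that the node step is pure algebra given (F8′)/(F5′)/(F7′). `ChainV := ChainVCore ∧ ChainVRadii`.
(`ReadoutsV`, whose landing block reads `DerivEncl` at the crossing per ▶F4, and `ValidV` follow in a third defs file
once that text is frozen.) MODEL-lattice rung TL-M3 only; nothing here is a statement about the Navier–Stokes equations,
and nothing is asserted.
-/

noncomputable section

-- the sub-problem namespace repeats the summit name by design (D-0017)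
set_option linter.dupNamespace false

namespace Summit.NavierStokesRegularity.NavierStokesRegularity.Theorems.TaylorModelV

open Set Literature.Analysis.FluidPDE.TaoCascade Literature.Analysis.FluidPDE.TaoCascade.TaylorChain
open Summit.NavierStokesRegularity.NavierStokesRegularity.Theorems.TaylorModelReadout

/-- Componentwise absolute bound on the window: `|v i k| ≤ r i k` for `-Kb ≤ k ≤ Ka` (off-window components free).
[folklore] -/
def AbsLeW (cd : CertData) (v r : Fin 4 → ℤ → ℝ) : Prop := ∀ i k, -cd.Kb ≤ k → k ≤ cd.Ka → |v i k| ≤ r i k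

/-- A window KERNEL: a real matrix indexed by pairs of shell indices (row `(i', k')`, column `(i, k)`). [folklore] -/
abbrev Ker : Type := Fin 4 → ℤ → Fin 4 → ℤ → ℝ

/-- Entrywise membership of a kernel in the kernel interval `[lo, hi]` (window rows and columns only). [folklore] -/
def KerMem (cd : CertData) (A lo hi : Ker) : Prop :=
  ∀ i' k', -cd.Kb ≤ k' → k' ≤ cd.Ka → ∀ i k, -cd.Kb ≤ k → k ≤ cd.Ka →
    lo i' k' i k ≤ A i' k' i k ∧ A i' k' i k ≤ hi i' k' i k

/-- ACTION of a kernel on a state through the semantic window enumeration — on window rows literally the right-hand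
side of (F8′) of `IsFlowPackageV`; zero off the window rows. [folklore] -/
def kapp (cd : CertData) (A : Ker) (v : Fin 4 → ℤ → ℝ) : Fin 4 → ℤ → ℝ := fun i' k' =>
  if -cd.Kb ≤ k' ∧ k' ≤ cd.Ka then ∑ c : Fin (nW cd), A i' k' (modeOf cd c) (shellOf cd c) * toVec cd v c else 0

/-- The kernel of a map on states (its matrix on the window basis `basisSt`). [folklore] -/
def kerOf (L : (Fin 4 → ℤ → ℝ) → (Fin 4 → ℤ → ℝ)) : Ker := fun i' k' i k => L (basisSt i k) i' k'

/-- **Radii record** — the successor's part of the v3 carrier (PROPAGATE-V-SPEC-cert1 rev. §1, «NODE STATE»): per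
stage `j` the polytope box radii `rB j` and the scaling map `Dsc j` (`q = x j 0 + Dsc j ζ`, `|ζ| ≤ rB j` on the
window); per node `(j,s)` the POINT transport `Vc j s` (linear, window-supported), the plain set-error radii `e j s`
and the derivative-error kernel interval `Zlo j s ≤ · ≤ Zhi j s` (coordinates of the frame `cd.Cm j s`); per sub-step
`(j,s)` the fresh centre-error bound `ν j s`. The centre-trajectory radii are `bx.rPl 0` and the error frame is
`cd.Cm`/`cd.Ci` — no duplicate fields. All functions junk-valued beyond the indices used. [folklore] -/
structure RadiiData where
  rB : ℕ → (Fin 4 → ℤ → ℝ)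
  Dsc : ℕ → (Fin 4 → ℤ → ℝ) → (Fin 4 → ℤ → ℝ)
  Vc : ℕ → ℕ → (Fin 4 → ℤ → ℝ) → (Fin 4 → ℤ → ℝ)
  (e ν : ℕ → ℕ → (Fin 4 → ℤ → ℝ))
  (Zlo Zhi : ℕ → ℕ → Ker)

/-- **Level-1 node pair** at node `(j,s)`: a centre-trajectory point `y₀ ∈ X⁰_s` (`NodeStart … 0`), a polytope
parameter `ζ` with `|ζ| ≤ rB j`, and the state `y` with `y − y₀ − Vc j s ζ` in the plain error box `[−e, e]` — the
affine parametrisation `φ(x j 0 + Dsc ζ)(Tn s) ∈ φ(x j 0)(Tn s) + Vc_s ζ + [−e_s, e_s]` of PROPAGATE-V-SPEC §1 «X¹».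
[folklore] -/
def NodePair (cd : CertData) (bx : StepBoxes) (rd : RadiiData) (j s : ℕ) (ζ y₀ y : Fin 4 → ℤ → ℝ) : Prop :=
  NodeStart cd bx j s 0 y₀ ∧ AbsLeW cd ζ (rd.rB j) ∧ AbsLeW cd (y - y₀ - rd.Vc j s ζ) (rd.e j s)

/-- **Derivative enclosure** at node `(j,s)`: the kernel `L` (the window derivative of `q ↦ φ(q)(Tn s)` composed with
`Dsc j`, supplied by the G-side) lies in `Vc_s + Cm_s·[Zlo, Zhi]`: some kernel `W` of the interval with
`L·v = Vc v + Cm (W·v)` for window-supported `v`. [folklore] -/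
def DerivEncl (cd : CertData) (rd : RadiiData) (j s : ℕ) (L : Ker) : Prop :=
  ∃ W : Ker, KerMem cd W (rd.Zlo j s) (rd.Zhi j s) ∧
    ∀ v, cd.Wsupp v → kapp cd L v = rd.Vc j s v + cd.Cm j s (kapp cd W v)

/-- **(TM-V radii) the cross-step part of the vector-step chain predicate** — see the module docstring. Per stage
`j ≤ N₀`: STAGE clauses (`Dsc` linear/window-supported, `rB ≥ 0`, ENTRY: every polytope point is `x j 0 + Dsc ζ` on
the window with `|ζ| ≤ rB`, `Vc j 0 = Dsc j`, `0 ∈ [Z j 0]`); NODE clauses `s ≤ S` (`Vc` linear/window-supported,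
`e ≥ 0`, HINGE: level-1 pairs lie in the hull `[hlo 1, hhi 1]`); SUB-STEP clauses `s < S`: (R3) the fresh centre
error `|TP(h) − x'| + J·h^(p+1) ≤ ν`, and for EVERY kernel `A ∈ [Mlo, Mhi]`: (R2) centre radii absorption
`|Ci' (A·(Cm ξ) + r)| ≤ rPl 0 (s+1)` for `|ξ| ≤ rPl 0 s`, `|r| ≤ ν`; (R4) plain set error
`|A·(Vc ζ + d) − Vc' ζ| ≤ e'` for `|ζ| ≤ rB`, `|d| ≤ e`; (R5) derivative-error transport
`A·(Vc + Cm·W) ∈ Vc' + Cm'·[Z']` for every `W ∈ [Z]`. [folklore] -/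
def ChainVRadii (cd : CertData) (bx : StepBoxes) (rd : RadiiData) : Prop :=
  ∀ j, j ≤ cd.N₀ →
    -- stage clauses and ENTRY
    IsLinearMap ℝ (rd.Dsc j) ∧ (∀ v, cd.Wsupp (rd.Dsc j v)) ∧ (∀ i k, 0 ≤ rd.rB j i k) ∧
    (∀ q, InPoly cd j q → ∃ ζ : Fin 4 → ℤ → ℝ, AbsLeW cd ζ (rd.rB j) ∧
      ∀ i k, -cd.Kb ≤ k → k ≤ cd.Ka → q i k = (cd.x j 0 + rd.Dsc j ζ) i k) ∧
    (∀ v, rd.Vc j 0 v = rd.Dsc j v) ∧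
    KerMem cd (fun _ _ _ _ => 0) (rd.Zlo j 0) (rd.Zhi j 0) ∧
    -- node clauses
    (∀ s', s' ≤ cd.S j →
      IsLinearMap ℝ (rd.Vc j s') ∧ (∀ v, cd.Wsupp (rd.Vc j s' v)) ∧ (∀ i k, 0 ≤ rd.e j s' i k) ∧
      (∀ ζ y₀ y, NodePair cd bx rd j s' ζ y₀ y → InBox cd (bx.hlo 1 j s') (bx.hhi 1 j s') y)) ∧
    -- sub-step clauses
    (∀ s', s' < cd.S j →
      -- (R3) fresh centre error
      (∀ i k, -cd.Kb ≤ k → k ≤ cd.Ka →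
        |cd.TP j s' (cd.h j s') i k - cd.x j (s' + 1) i k| + bx.J j s' i k * cd.h j s' ^ (cd.pdeg + 1)
          ≤ rd.ν j s' i k) ∧
      -- (R2) centre radii absorption through the next frame's inverse
      (∀ A : Ker, KerMem cd A (bx.Mlo j s') (bx.Mhi j s') → ∀ ξ r : Fin 4 → ℤ → ℝ,
        AbsLeW cd ξ (bx.rPl 0 j s') → AbsLeW cd r (rd.ν j s') →
          AbsLeW cd (cd.Ci j (s' + 1) (kapp cd A (cd.Cm j s' ξ) + r)) (bx.rPl 0 j (s' + 1))) ∧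
      -- (R4) plain set-error update
      (∀ A : Ker, KerMem cd A (bx.Mlo j s') (bx.Mhi j s') → ∀ ζ d : Fin 4 → ℤ → ℝ,
        AbsLeW cd ζ (rd.rB j) → AbsLeW cd d (rd.e j s') →
          AbsLeW cd (kapp cd A (rd.Vc j s' ζ + d) - rd.Vc j (s' + 1) ζ) (rd.e j (s' + 1))) ∧
      -- (R5) derivative-error transport
      (∀ A : Ker, KerMem cd A (bx.Mlo j s') (bx.Mhi j s') → ∀ W : Ker, KerMem cd W (rd.Zlo j s') (rd.Zhi j s') →
        ∃ W' : Ker, KerMem cd W' (rd.Zlo j (s' + 1)) (rd.Zhi j (s' + 1)) ∧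
          ∀ v, cd.Wsupp v →
            kapp cd A (rd.Vc j s' v + cd.Cm j s' (kapp cd W v)) = rd.Vc j (s' + 1) v + cd.Cm j (s' + 1) (kapp cd W' v)))

/-- **The v3 chain predicate** = flow-side core (tm-g4) ∧ cross-step radii (this file). [folklore] -/
def ChainV (cd : CertData) (bx : StepBoxes) (rd : RadiiData) : Prop := ChainVCore cd bx ∧ ChainVRadii cd bx rd

end Summit.NavierStokesRegularity.NavierStokesRegularity.Theorems.TaylorModelV

end
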